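/-
Copyright (c) 2026 the pub-hodgecm-mathlib formalisation cell (harness21).  Prover seat hodgecm-mathlib-K2Liu-p12 (g7), Track B «K2-LIT»,
#184♮ = hLiu418 = `stmt-HodgeConjecture-24832`; #42S block D, row D-2, (σ-A) mini-road ((σ-A) road desk WORDS #51∕#53∕#56, desk (g4) WORDS #1 (2)∕#2 (2)∕#3:
brick (B2-coord) FILE B, part 2 of 2 «THE GRAPH READING, POINT LAYER — THE POINT FORMULA»).  THEOREMS ONLY (no `def`, no `instance`, no `notation`,
no named-fact hypothesis, no `sorry`).
-/
import Summits.HodgeConjecture.HodgeConjecture.Theorems.K2LiuConeGraphReadingPointCoords  -- (B2-coord) FILE B part 1: §0–§3 (+ ★ p865151, ★ p865154, ★ p865058, ★ F5c-A, ★ (C3-c))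
import Literature.NumberTheory.Automorphic.QuadraticRestrictionOfScalars                       -- ★ `isQuadraticCoordinates_local` (`re_add_im`, `mul_formula`)
import HarnessLib

/-!
# Crux `HLiu418`, #42S block D row D-2, (σ-A) brick (B2-coord) FILE B (part 2 of 2) `K2LiuConeGraphReadingPoint`:
# THE GRAPH READING, POINT LAYER — `P̂D⁻¹ (B⁻¹ (P̂D (x₁ ⊔ 0))) = y₁ ⊔ y₂` (`Z y₁ = G₀₀ · Z x₁`, `Z y₂ = G₁₀ · Z x₁`), AND THE EXPLICIT (K1)-READING

Cell `hodgecm-mathlib`, crux item hLiu418 = `stmt-HodgeConjecture-24832`; lane `--supports stmt-HodgeConjecture-24832 --as helper` (count-neutral helper).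

WHY.  ★ p865151 (B1) `K2LiuConeGraphReadingOperator.exists_levi_letter_toOp_boxLoc_localSplitting_tensorEmbLoc_apply` reads the conjugate of a small
Siegel–LEVI element `p₀ ⊗ 1` (`B(p₀) = 0 = C(p₀)`) through the implementer of record `E′ := π(frameMp_{PD} j̃(p₁, p₂))` as
`c · |det B|^{-1/2} · Ψ(P̂D⁻¹ (B⁻¹ (P̂D u)))` with an ∃-discharged Levi letter `B` (`hB : E′ · ι(p₀ ⊗ 1) · E′⁻¹ = transportSp 𝕋 (m(B))`).  K2Liu-p08's
(an-3c) §3b telescope (★ p864562 `coneWord_of_stageLetters`, slot `hL2 : N₁ x ζ = c_F · ∫_s V_x (Z_s ζ ⊔ s) dσ`) evaluates that at the integration point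
`u = P̂D (x₁ ⊔ 0)`; THIS FILE computes the point `P̂D⁻¹ (B⁻¹ (P̂D (x₁ ⊔ 0)))` IN THE BOX COORDINATES of the Schrödinger model, at the NORMALISED
implementer pair of record (desk ruling (N); ★ p865154 FILE B′), on top of part 1 (`K2LiuConeGraphReadingPointCoords`, §0–§3):
* §3′ **`halfDiff_eD_symm_toLin_inv_frameLin_glue`** (∕ `_zero`) — ★ (C3-c) `exists_pointReading` made EXPLICIT and two-block: the (K1)-reading
  `halfDiff (e_D⁻¹ (E′⁻¹ (P̂D (z₁ ⊔ z₂), 0))) (epsV (j, l)) = if j = i₀ then Z z₁ l else Z z₂ l`, `Z z l := ι z_{e₂(inl l)} + ι z_{e₂(inr l)} · δ̂` — the `b(z)` of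
  K2Liu-p08's pins (2a)(2b) BY VALUE (desk WORDS (g4) #2 (2) ∕ #3: the explicit `s_E` bytes of the reading «(2a-read)»; at `x₁ ⊔ 0` the Gram `G̃_{j̃}` is supported at
  `(i₀, i₀)` with entry `h_{S′}(Z x₁, Z x₁)`, from which (D) proves `hQf_sep`);
* §4 **`frameLin_symm_glEquiv_symm_frameLin_glue`** — THE POINT FORMULA: for `x₁ ∈ X₁` and ANY `y₁, y₂ ∈ X₁` with `Z y₁ = G i₀ i₀ · Z x₁`, `Z y₂ = G i₁ i₀ · Z x₁`
  (`G` the inverse `Δ⁻`-block of `p₀`: `D(p₀) · G = 1`): `P̂D⁻¹ (B⁻¹ (P̂D (x₁ ⊔ 0))) = y₁ ⊔ y₂`.  Chain: (B2-read) `B⁻¹ u = ((E′ · ι(p₀ ⊗ 1)⁻¹ · E′⁻¹)(u, 0)).1`;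
  part 1 §3 at `(x₁, 0)`; `ι⁻¹ ∘ e_D = e_D ∘ matA⁻¹`; `matA (p₀ ⊗ 1)⁻¹ · adblV = adblV ∘ reindex epsV (G ⊗ₖ 1)`; the slot action; part 1 §3 backwards at `(y₁, y₂)`;
  **`…_smul`** — if `G i₁ i₀ = ι λ` is REAL then `y₂ := λ • x₁` qualifies; **`…_explicit`** — `y₁` spelled out as `(re (G₀₀ · Z x₁ l), im (G₀₀ · Z x₁ l))_l` along `e₂`;
  **`…_of_hZm`** — DOCKED on ★ p864769's letter `hZm` (BY VALUE in (an-3c)): for any multiplication graph `Zm` with `hZm` at `d = d_v` along slot equivalences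
  enumerating the box coordinates as `(l, 0) ↦ e₂ (inl l)`, `(l, 1) ↦ e₂ (inr l)`: `P̂D⁻¹ (B⁻¹ (P̂D (x₁ ⊔ 0))) = Z_{x₁} (re G₀₀, im G₀₀) ⊔ (λ • x₁)` — the graph
  point of slot (L2).
[cite: Kudla1994, §3 Thm. 3.1] [cite: MoeglinVignerasWaldspurger1987, Chap. 2 II.1 Rem. (6), II.2, II.6] [cite: HarrisKudlaSweet1996, §1 (1.11)–(1.12)]
[cite: KudlaRallis1994, §2 (2.10)–(2.12)] [cite: Weil1964, n° 6, n° 34]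
HONEST LABEL.  Count-neutral helper; it retires nothing by itself: `HC_CM` is proved only modulo the 7 printed citations (2 remaining named inputs:
hLiu418 = `stmt-HodgeConjecture-24832`, h413 = `stmt-HodgeConjecture-24833`) until rung 0 closes.

## References
* [Kudla1994] S. S. Kudla, *Splitting metaplectic covers of dual reductive pairs*, Israel J. Math. 87 (1994), §3 Thm. 3.1.
* [MoeglinVignerasWaldspurger1987] C. Mœglin, M.-F. Vignéras, J.-L. Waldspurger, LNM 1291 (1987), Chap. 2 II.1 Rem. (6), II.2, II.6.
* [HarrisKudlaSweet1996] M. Harris, S. Kudla, W. J. Sweet, J. Amer. Math. Soc. 9 (1996), §1 (1.11)–(1.12).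
* [KudlaRallis1994] S. Kudla, S. Rallis, Ann. of Math. 140 (1994), §2 (2.10)–(2.12).
* [Weil1964] A. Weil, Acta Math. 111 (1964), n° 6, n° 34.
-/

set_option autoImplicit false
set_option linter.dupNamespace false -- the mandated namespace repeats `HodgeConjecture.HodgeConjecture`

noncomputable section

open scoped Matrix Kronecker
open NumberField IsDedekindDomain Matrix
open Literature.RepresentationTheory.HeisenbergGroup Literature.RepresentationTheory.HeisenbergGroup.SymplecticMatrix
open Literature.NumberTheory.Automorphic Literature.NumberTheory.Automorphic.UnitaryGroup Literature.NumberTheory.Weil1964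
open Literature.NumberTheory.GelbartRogawski1991 Literature.NumberTheory.GelbartRogawski1991.GRConstruction
open Literature.NumberTheory.GelbartRogawski1991.AdaptedBlocks
open Literature.NumberTheory.GelbartRogawski1991.UnitaryDualPair
open Literature.NumberTheory.GelbartRogawski1991.UnitaryDualPair.LocalSplitting
open Literature.NumberTheory.GelbartRogawski1991.UnitaryDualPair.LocalSplitting.FrameTransport
open Literature.NumberTheory.GelbartRogawski1991.UnitaryDualPair.LocalSplitting.DoubledBlock
open Literature.NumberTheory.K2Lit.SiegelDoubled
open Summit.HodgeConjecture.HodgeConjecture.Cruxes.HLiu418.K2LiuLocalSWSectionDefs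
open Summit.HodgeConjecture.HodgeConjecture.Cruxes.HLiu418.K2LiuLocalSWTensorAdaptedBlocks
open Summit.HodgeConjecture.HodgeConjecture.Cruxes.HLiu418.K2LiuConeGraphReadingPointCoords

namespace Summit.HodgeConjecture.HodgeConjecture.Cruxes.HLiu418.K2LiuConeGraphReadingPoint

section Tensor

variable (L : Type) [Field L] [NumberField L] [IsCMField L]
variable {N M : ℕ} (e : Fin N × Fin M ≃ Fin 2)
  (dV : Fin N → L) (hdV : ∀ i, IsCMField.complexConj L (dV i) = dV i)
  (dW : Fin M → L) (hdW : ∀ i, IsCMField.complexConj L (dW i) = dW i)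
variable {M₂ M' : ℕ} (eW : Fin M × Fin M₂ ≃ Fin M') (e' : Fin N × Fin M' ≃ Fin (M₂ + M₂))
  (dV' : Fin M₂ → L) (hdV' : ∀ k, IsCMField.complexConj L (dV' k) = dV' k)
  (v : HeightOneSpectrum (𝓞 (Fp L)))

section Normalised

variable {σ : Equiv.Perm (Fin (M₂ + M₂))} {T₁ T₂ : Matrix (Fin M₂) (Fin M₂) (Fp L)}
  (P : GL (Fin (M₂ + M₂)) (Fp L)) (hPσ : (P : Matrix (Fin (M₂ + M₂)) (Fin (M₂ + M₂)) (Fp L)) = σ.toPEquiv.toMatrix)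
  (hP : ((P : Matrix (Fin (M₂ + M₂)) (Fin (M₂ + M₂)) (Fp L)))ᵀ *
      gramR L e' dV hdV (tensorFrame L dW eW dV') (tensorFrame_real L dW hdW eW dV' hdV') * (P : Matrix _ _ (Fp L)) =
    UnitaryGroup.finSum M₂ M₂ T₁ T₂)
  {PD : GL (Fin ((M₂ + M₂) + (M₂ + M₂))) (Fp L)} (hPD : PD = UnitaryGroup.reindexGL (e₂ (M₂ + M₂)) (UnitaryGroup.blockDiagGL (P, P)))
  -- the NORMALISED implementer pair of record (★ B′: `π(p̂ᵢ) = transportSp 𝕋ᵢ (m(Qᵢ)·κᵢ)`, `κᵢ` the Cayley matrix along `e₂ ⊕ e₂`, `Qᵢ⁻¹ = 2 ⊕ Tᵢ` along `e₂`)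
  (hTv₁ : IsUnit (localGram (Fp L) (M₂ + M₂) (gramD (Fp L) M₂ T₁) v).det)
  (K₁ : Matrix.symplecticGroup (Fin (M₂ + M₂)) (v.adicCompletion (Fp L)))
  (hK₁ : (K₁ : Matrix (Fin (M₂ + M₂) ⊕ Fin (M₂ + M₂)) (Fin (M₂ + M₂) ⊕ Fin (M₂ + M₂)) (v.adicCompletion (Fp L))) =
    Matrix.reindex ((e₂ M₂).sumCongr (e₂ M₂)) ((e₂ M₂).sumCongr (e₂ M₂))
      (Matrix.fromBlocks (Matrix.fromBlocks 1 (-1) 0 0)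
          (Matrix.fromBlocks 0 0 ((⅟(2 : v.adicCompletion (Fp L))) • 1) ((⅟(2 : v.adicCompletion (Fp L))) • 1))
          (Matrix.fromBlocks 0 0 (-1) (-1))
          (Matrix.fromBlocks ((⅟(2 : v.adicCompletion (Fp L))) • 1) (-((⅟(2 : v.adicCompletion (Fp L))) • 1)) 0 0) :
        Matrix ((Fin M₂ ⊕ Fin M₂) ⊕ (Fin M₂ ⊕ Fin M₂)) ((Fin M₂ ⊕ Fin M₂) ⊕ (Fin M₂ ⊕ Fin M₂)) (v.adicCompletion (Fp L))))
  (Q₁ : GL (Fin (M₂ + M₂)) (v.adicCompletion (Fp L)))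
  (hQ₁ : ((Q₁⁻¹ : GL (Fin (M₂ + M₂)) (v.adicCompletion (Fp L))) : Matrix (Fin (M₂ + M₂)) (Fin (M₂ + M₂)) (v.adicCompletion (Fp L))) =
    Matrix.reindex (e₂ M₂) (e₂ M₂) (Matrix.fromBlocks ((2 : v.adicCompletion (Fp L)) • 1) 0 0 (localGram (Fp L) M₂ T₁ v)))
  (p₁ : LocalMp (Fp L) (M₂ + M₂) (gramD (Fp L) M₂ T₁) v)
  (hp₁ : MpPsi.proj _ p₁ = transportSp (localGram (Fp L) (M₂ + M₂) (gramD (Fp L) M₂ T₁) v) hTv₁ (levi Q₁ * K₁))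
  (hTv₂ : IsUnit (localGram (Fp L) (M₂ + M₂) (gramD (Fp L) M₂ T₂) v).det)
  (K₂ : Matrix.symplecticGroup (Fin (M₂ + M₂)) (v.adicCompletion (Fp L)))
  (hK₂ : (K₂ : Matrix (Fin (M₂ + M₂) ⊕ Fin (M₂ + M₂)) (Fin (M₂ + M₂) ⊕ Fin (M₂ + M₂)) (v.adicCompletion (Fp L))) =
    Matrix.reindex ((e₂ M₂).sumCongr (e₂ M₂)) ((e₂ M₂).sumCongr (e₂ M₂))
      (Matrix.fromBlocks (Matrix.fromBlocks 1 (-1) 0 0)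
          (Matrix.fromBlocks 0 0 ((⅟(2 : v.adicCompletion (Fp L))) • 1) ((⅟(2 : v.adicCompletion (Fp L))) • 1))
          (Matrix.fromBlocks 0 0 (-1) (-1))
          (Matrix.fromBlocks ((⅟(2 : v.adicCompletion (Fp L))) • 1) (-((⅟(2 : v.adicCompletion (Fp L))) • 1)) 0 0) :
        Matrix ((Fin M₂ ⊕ Fin M₂) ⊕ (Fin M₂ ⊕ Fin M₂)) ((Fin M₂ ⊕ Fin M₂) ⊕ (Fin M₂ ⊕ Fin M₂)) (v.adicCompletion (Fp L))))
  (Q₂ : GL (Fin (M₂ + M₂)) (v.adicCompletion (Fp L)))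
  (hQ₂ : ((Q₂⁻¹ : GL (Fin (M₂ + M₂)) (v.adicCompletion (Fp L))) : Matrix (Fin (M₂ + M₂)) (Fin (M₂ + M₂)) (v.adicCompletion (Fp L))) =
    Matrix.reindex (e₂ M₂) (e₂ M₂) (Matrix.fromBlocks ((2 : v.adicCompletion (Fp L)) • 1) 0 0 (localGram (Fp L) M₂ T₂ v)))
  (p₂ : LocalMp (Fp L) (M₂ + M₂) (gramD (Fp L) M₂ T₂) v)
  (hp₂ : MpPsi.proj _ p₂ = transportSp (localGram (Fp L) (M₂ + M₂) (gramD (Fp L) M₂ T₂) v) hTv₂ (levi Q₂ * K₂))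

variable {i₀ i₁ : Fin 2} (hi : i₀ ≠ i₁)
  (hσ₀ : ∀ k, σ (epsV e eW e' (i₀, k)) = finSumFinEquiv (Sum.inl k)) (hσ₁ : ∀ k, σ (epsV e eW e' (i₁, k)) = finSumFinEquiv (Sum.inr k))

/-! ## §3′ The explicit (K1)-reading of the two-block point; §4 THE POINT FORMULA -/

variable (hTv : IsUnit (localGram (Fp L) ((M₂ + M₂) + (M₂ + M₂))
    (gramD (Fp L) (M₂ + M₂) (gramR L e' dV hdV (tensorFrame L dW eW dV') (tensorFrame_real L dW hdW eW dV' hdV'))) v).det)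
  -- the small Siegel–Levi element, the inverse of its `Δ⁻`-block, and its ∃-discharged Levi letter at `E′ := π(frameMp_{PD} j̃(p₁, p₂))` (★ p865151 §1)
  (p₀ : UnitaryGroup.localPi L (IsCMField.complexConj L) (2 + 2) (hermD L e dV hdV dW hdW) v)
  (hB0 : blkB (matA (Fp L) L (IsCMField.complexConj L) v 2 p₀) = 0) (G : Matrix (Fin 2) (Fin 2) (LocalRing L v))
  (hG : blkD (matA (Fp L) L (IsCMField.complexConj L) v 2 p₀) * G = 1)
  (B : GL (Fin ((M₂ + M₂) + (M₂ + M₂))) (v.adicCompletion (Fp L)))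
  (hB : MpPsi.proj _ (frameMp (Fp L) v ((M₂ + M₂) + (M₂ + M₂)) PD (transpose_pd_mul_gramD_mul_pd (Fp L) (M₂ + M₂) P hP hPD)
          (boxLoc (Fp L) v M₂ M₂ (T₁ := T₁) (T₂ := T₂) (p₁, p₂))) *
        iotaD (Fp L) L (IsCMField.complexConj L) (complexConj_imagUnit L) (imagUnit_ne_zero L) (imagUnit_mul_self L) v (M₂ + M₂)
          (gramR_isSymm L e' dV hdV (tensorFrame L dW eW dV') (tensorFrame_real L dW hdW eW dV' hdV'))
          (hermD_eq_map_gramD L e' dV hdV (tensorFrame L dW eW dV') (tensorFrame_real L dW hdW eW dV' hdV'))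
          (tensorEmbLoc L e dV hdV dW hdW eW e' dV' hdV' v p₀) *
        (MpPsi.proj _ (frameMp (Fp L) v ((M₂ + M₂) + (M₂ + M₂)) PD (transpose_pd_mul_gramD_mul_pd (Fp L) (M₂ + M₂) P hP hPD)
          (boxLoc (Fp L) v M₂ M₂ (T₁ := T₁) (T₂ := T₂) (p₁, p₂))))⁻¹ =
      transportSp (localGram (Fp L) ((M₂ + M₂) + (M₂ + M₂))
          (gramD (Fp L) (M₂ + M₂) (gramR L e' dV hdV (tensorFrame L dW eW dV') (tensorFrame_real L dW hdW eW dV' hdV'))) v) hTv (levi B))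

set_option maxHeartbeats 800000 in -- the `toLin`∕`MpPsi.proj` letters of ★ (C3-c)'s shape in the rewrite with part 1 §3
include hPσ hK₁ hQ₁ hp₁ hK₂ hQ₂ hp₂ hi hσ₀ hσ₁ in
/-- **THE (K1)-READING OF THE TWO-BLOCK POINT, EXPLICIT** (★ (C3-c) `exists_pointReading` with its `cX` COMPUTED, both blocks): at the normalised pair,
`halfDiff (e_D⁻¹ (E′⁻¹ (P̂D (z₁ ⊔ z₂), 0))) (epsV (j, l)) = if j = i₀ then Z z₁ l else Z z₂ l`, `Z z l = ι z_{e₂(inl l)} + ι z_{e₂(inr l)} · δ̂` — the `b(z)` of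
K2Liu-p08's pins (2a)(2b) (`G̃_{j̃}(z)_{ji} = Σ_{k,l} b_{jl}(z) · S′_{kl} · σ(b_{ik}(z))`) BY VALUE: row `i₀` is the plain quadratic coordinate vector of `z₁`, row `i₁` that of `z₂`.
[cite: Kudla1994, §2, §3 Thm. 3.1] [cite: HarrisKudlaSweet1996, §1 (1.11)] [cite: MoeglinVignerasWaldspurger1987, Chap. 2 II.1 Rem. (6)] -/
theorem halfDiff_eD_symm_toLin_inv_frameLin_glue (z₁ z₂ : Fin (M₂ + M₂) → v.adicCompletion (Fp L)) (j : Fin 2) (l : Fin M₂) :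
    halfDiff ((eD (Fp L) L (IsCMField.complexConj L) (complexConj_imagUnit L) (imagUnit_ne_zero L) (imagUnit_mul_self L) v (M₂ + M₂)).symm
        (toLin (Fp L) v (MpPsi.proj _ (frameMp (Fp L) v ((M₂ + M₂) + (M₂ + M₂)) PD (transpose_pd_mul_gramD_mul_pd (Fp L) (M₂ + M₂) P hP hPD)
            (boxLoc (Fp L) v M₂ M₂ (T₁ := T₁) (T₂ := T₂) (p₁, p₂))))⁻¹
          (frameLin (Fp L) v ((M₂ + M₂) + (M₂ + M₂)) PD (glue (blkIdx M₂ M₂) z₁ z₂), 0)))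
      (epsV e eW e' (j, l)) =
    if j = i₀ then
      UnitaryGroup.toLocalRing L v (z₁ (e₂ M₂ (Sum.inl l))) + UnitaryGroup.toLocalRing L v (z₁ (e₂ M₂ (Sum.inr l))) * algebraMap L (LocalRing L v) (imagUnit L)
    else
      UnitaryGroup.toLocalRing L v (z₂ (e₂ M₂ (Sum.inl l))) + UnitaryGroup.toLocalRing L v (z₂ (e₂ M₂ (Sum.inr l))) * algebraMap L (LocalRing L v) (imagUnit L) := by
  haveI : Algebra.IsQuadraticExtension (Fp L) L := IsCMField.isQuadraticExtension L
  dsimp only [LocalSplitting.toLin]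
  rw [LinearEquiv.coe_coe, Subgroup.coe_inv, LinearEquiv.coe_inv,
    symm_apply_frameLin_glue_eq_eD_adblV L dV hdV dW hdW eW e' dV' hdV' v P hPσ hP hPD hTv₁ K₁ hK₁ Q₁ hQ₁ p₁ hp₁ hTv₂ K₂ hK₂ Q₂ hQ₂ p₂ hp₂ z₁ z₂,
    LinearEquiv.symm_apply_apply, halfDiff_adblV, Function.comp_apply]
  by_cases hj : j = i₀
  · rw [if_pos hj, hj, hσ₀, glue_apply_inl]
  · have hj1 : j = i₁ := by omega
    rw [if_neg hj, hj1, hσ₁, glue_apply_inr]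

set_option maxHeartbeats 800000 in -- idem
include hPσ hK₁ hQ₁ hp₁ hK₂ hQ₂ hp₂ hi hσ₀ hσ₁ in
/-- **THE (K1)-READING OF THE INTEGRATION POINT `x₁ ⊔ 0`, EXPLICIT**: ★ (C3-c) `exists_pointReading`'s shape `if j = i₀ then cX x₁ l else 0` WITH
`cX x₁ l = ι x₁_{e₂(inl l)} + ι x₁_{e₂(inr l)} · δ̂` (the normalised pair's reading is plain `(re, im)` along `e₂`, ★ B′) — the explicit `s_E` bytes of (2a-read)
(desk WORDS (g4) #2 (2) ∕ #3): `G̃_{j̃}(x₁ ⊔ 0)` is supported at `(i₀, i₀)` with entry `h_{S′}(Z x₁, Z x₁)`.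
[cite: Kudla1994, §3 Thm. 3.1] [cite: HarrisKudlaSweet1996, §1 (1.11)] -/
theorem halfDiff_eD_symm_toLin_inv_frameLin_glue_zero (x₁ : Fin (M₂ + M₂) → v.adicCompletion (Fp L)) (j : Fin 2) (l : Fin M₂) :
    halfDiff ((eD (Fp L) L (IsCMField.complexConj L) (complexConj_imagUnit L) (imagUnit_ne_zero L) (imagUnit_mul_self L) v (M₂ + M₂)).symm
        (toLin (Fp L) v (MpPsi.proj _ (frameMp (Fp L) v ((M₂ + M₂) + (M₂ + M₂)) PD (transpose_pd_mul_gramD_mul_pd (Fp L) (M₂ + M₂) P hP hPD)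
            (boxLoc (Fp L) v M₂ M₂ (T₁ := T₁) (T₂ := T₂) (p₁, p₂))))⁻¹
          (frameLin (Fp L) v ((M₂ + M₂) + (M₂ + M₂)) PD (glue (blkIdx M₂ M₂) x₁ 0), 0)))
      (epsV e eW e' (j, l)) =
    if j = i₀ then
      UnitaryGroup.toLocalRing L v (x₁ (e₂ M₂ (Sum.inl l))) + UnitaryGroup.toLocalRing L v (x₁ (e₂ M₂ (Sum.inr l))) * algebraMap L (LocalRing L v) (imagUnit L)
    else 0 := by
  rw [halfDiff_eD_symm_toLin_inv_frameLin_glue L e dV hdV dW hdW eW e' dV' hdV' v P hPσ hP hPD hTv₁ K₁ hK₁ Q₁ hQ₁ p₁ hp₁ hTv₂ K₂ hK₂ Q₂ hQ₂ p₂ hp₂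
    hi hσ₀ hσ₁ x₁ 0 j l]
  by_cases hj : j = i₀
  · rw [if_pos hj, if_pos hj]
  · rw [if_neg hj, if_neg hj, Pi.zero_apply, Pi.zero_apply, map_zero, zero_mul, add_zero]

set_option maxHeartbeats 1600000 in -- §2∕§3 rewrites under the `LocalMp` letters + the group algebra on the conjugate `E′ · ι(p₀ ⊗ 1) · E′⁻¹`
include hPσ hK₁ hQ₁ hp₁ hK₂ hQ₂ hp₂ hi hσ₀ hσ₁ hB0 hG hB in
/-- **(B2-coord) THE GRAPH READING, POINT LAYER.**  At the normalised implementer pair of record, for the ∃-discharged Levi letter `B` of a small Siegel–Levi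
`p₀ ⊗ 1` at `E′ = π(frameMp_{PD} j̃(p̂₁, p̂₂))` (★ p865151 §1's `hB` bytes) with `B(p₀) = 0`, `D(p₀) · G = 1`, and for every `x₁ ∈ X₁` and ANY `y₁, y₂ ∈ X₁` whose
plain quadratic coordinates are `Z y₁ = G i₀ i₀ · Z x₁`, `Z y₂ = G i₁ i₀ · Z x₁`:
`P̂D⁻¹ (B⁻¹ (P̂D (x₁ ⊔ 0))) = y₁ ⊔ y₂` — the point at which ★ p865151 evaluates `Ψ` IS the two-block point `y₁ ⊔ y₂` (the FIRST COLUMN of the inverse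
`Δ⁻`-block `G` acting by quadratic-coordinate multiplication).  Chain: (B2-read) `B⁻¹ u = ((E′ ι(p₀⊗1)⁻¹ E′⁻¹)(u, 0)).1`; §3 at `(x₁, 0)`; `ι⁻¹ ∘ e_D = e_D ∘ matA⁻¹`
(§1); `matA (p₀ ⊗ 1)⁻¹ · adblV = adblV ∘ reindex epsV (G ⊗ 1)` (§1); the slot action (§3); §3 backwards at `(y₁, y₂)`.
[cite: Kudla1994, §3 Thm. 3.1] [cite: MoeglinVignerasWaldspurger1987, Chap. 2 II.1 Rem. (6), II.2, II.6] [cite: HarrisKudlaSweet1996, §1 (1.11)–(1.12)] [cite: Weil1964, n° 6, n° 34] -/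
theorem frameLin_symm_glEquiv_symm_frameLin_glue (x₁ y₁ y₂ : Fin (M₂ + M₂) → v.adicCompletion (Fp L))
    (hy₁ : ∀ l : Fin M₂, UnitaryGroup.toLocalRing L v (y₁ (e₂ M₂ (Sum.inl l))) +
        UnitaryGroup.toLocalRing L v (y₁ (e₂ M₂ (Sum.inr l))) * algebraMap L (LocalRing L v) (imagUnit L) =
      G i₀ i₀ * (UnitaryGroup.toLocalRing L v (x₁ (e₂ M₂ (Sum.inl l))) +
        UnitaryGroup.toLocalRing L v (x₁ (e₂ M₂ (Sum.inr l))) * algebraMap L (LocalRing L v) (imagUnit L)))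
    (hy₂ : ∀ l : Fin M₂, UnitaryGroup.toLocalRing L v (y₂ (e₂ M₂ (Sum.inl l))) +
        UnitaryGroup.toLocalRing L v (y₂ (e₂ M₂ (Sum.inr l))) * algebraMap L (LocalRing L v) (imagUnit L) =
      G i₁ i₀ * (UnitaryGroup.toLocalRing L v (x₁ (e₂ M₂ (Sum.inl l))) +
        UnitaryGroup.toLocalRing L v (x₁ (e₂ M₂ (Sum.inr l))) * algebraMap L (LocalRing L v) (imagUnit L))) :
    (frameLin (Fp L) v ((M₂ + M₂) + (M₂ + M₂)) PD).symm
        ((glEquiv B).symm (frameLin (Fp L) v ((M₂ + M₂) + (M₂ + M₂)) PD (glue (blkIdx M₂ M₂) x₁ 0))) =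
      glue (blkIdx M₂ M₂) y₁ y₂ := by
  haveI : Algebra.IsQuadraticExtension (Fp L) L := IsCMField.isQuadraticExtension L
  rw [LinearEquiv.symm_apply_eq,
    (K2LiuConeGraphReadingOperator.inv_mulVec_eq_fst_apply_of_eq_transportSp_levi (Fp L) v hTv _ B hB
      (frameLin (Fp L) v ((M₂ + M₂) + (M₂ + M₂)) PD (glue (blkIdx M₂ M₂) x₁ 0))).2]
  simp only [_root_.mul_inv_rev, inv_inv, Subgroup.coe_mul, Subgroup.coe_inv, LinearEquiv.mul_apply, LinearEquiv.coe_inv]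
  rw [symm_apply_frameLin_glue_eq_eD_adblV L dV hdV dW hdW eW e' dV' hdV' v P hPσ hP hPD hTv₁ K₁ hK₁ Q₁ hQ₁ p₁ hp₁ hTv₂ K₂ hK₂ Q₂ hQ₂ p₂ hp₂ x₁ 0,
    coe_iotaD_symm_eD, matA_tensorEmbLoc_inv_mulVec_adblV L e dV hdV dW hdW eW e' dV' hdV' v p₀ hB0 G hG,
    reindex_kronecker_one_mulVec_glue_comp L e eW e' v hi hσ₀ hσ₁ G x₁ y₁ y₂ hy₁ hy₂,
    ← symm_apply_frameLin_glue_eq_eD_adblV L dV hdV dW hdW eW e' dV' hdV' v P hPσ hP hPD hTv₁ K₁ hK₁ Q₁ hQ₁ p₁ hp₁ hTv₂ K₂ hK₂ Q₂ hQ₂ p₂ hp₂ y₁ y₂,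
    LinearEquiv.apply_symm_apply]

include hPσ hK₁ hQ₁ hp₁ hK₂ hQ₂ hp₂ hi hσ₀ hσ₁ hB0 hG hB in
/-- **THE POINT FORMULA, REAL SECOND SLOT**: if the off-diagonal entry of the inverse `Δ⁻`-block is REAL, `G i₁ i₀ = ι λ`, then
`P̂D⁻¹ (B⁻¹ (P̂D (x₁ ⊔ 0))) = y₁ ⊔ (λ • x₁)` for any `y₁` with `Z y₁ = G i₀ i₀ · Z x₁` (`Z (λ • x₁) = ι λ · Z x₁`).
[cite: Kudla1994, §3 Thm. 3.1] [cite: HarrisKudlaSweet1996, §1 (1.11)–(1.12)] -/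
theorem frameLin_symm_glEquiv_symm_frameLin_glue_smul (lam : v.adicCompletion (Fp L)) (hlam : G i₁ i₀ = UnitaryGroup.toLocalRing L v lam)
    (x₁ y₁ : Fin (M₂ + M₂) → v.adicCompletion (Fp L))
    (hy₁ : ∀ l : Fin M₂, UnitaryGroup.toLocalRing L v (y₁ (e₂ M₂ (Sum.inl l))) +
        UnitaryGroup.toLocalRing L v (y₁ (e₂ M₂ (Sum.inr l))) * algebraMap L (LocalRing L v) (imagUnit L) =
      G i₀ i₀ * (UnitaryGroup.toLocalRing L v (x₁ (e₂ M₂ (Sum.inl l))) +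
        UnitaryGroup.toLocalRing L v (x₁ (e₂ M₂ (Sum.inr l))) * algebraMap L (LocalRing L v) (imagUnit L))) :
    (frameLin (Fp L) v ((M₂ + M₂) + (M₂ + M₂)) PD).symm
        ((glEquiv B).symm (frameLin (Fp L) v ((M₂ + M₂) + (M₂ + M₂)) PD (glue (blkIdx M₂ M₂) x₁ 0))) =
      glue (blkIdx M₂ M₂) y₁ (lam • x₁) :=
  frameLin_symm_glEquiv_symm_frameLin_glue L e dV hdV dW hdW eW e' dV' hdV' v P hPσ hP hPD hTv₁ K₁ hK₁ Q₁ hQ₁ p₁ hp₁ hTv₂ K₂ hK₂ Q₂ hQ₂ p₂ hp₂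
    hi hσ₀ hσ₁ hTv p₀ hB0 G hG B hB x₁ y₁ (lam • x₁) hy₁ fun l => by
      simp only [Pi.smul_apply, smul_eq_mul, map_mul, hlam, mul_add, mul_assoc]

include hPσ hK₁ hQ₁ hp₁ hK₂ hQ₂ hp₂ hi hσ₀ hσ₁ hB0 hG hB in
/-- **THE POINT FORMULA, EXPLICIT**: `P̂D⁻¹ (B⁻¹ (P̂D (x₁ ⊔ 0))) = y₁ ⊔ (λ • x₁)` with the first block SPELLED OUT in the box coordinates along `e₂`:
`y₁ (e₂ (inl l)) = re (G₀₀ · Z x₁ l)`, `y₁ (e₂ (inr l)) = im (G₀₀ · Z x₁ l)` (`re`∕`im` of ★ `quadraticLocalEquiv`; ★ `IsQuadraticCoordinates.re_add_im`).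
[cite: Kudla1994, §3 Thm. 3.1] [cite: HarrisKudlaSweet1996, §1 (1.11)–(1.12)] -/
theorem frameLin_symm_glEquiv_symm_frameLin_glue_explicit (lam : v.adicCompletion (Fp L)) (hlam : G i₁ i₀ = UnitaryGroup.toLocalRing L v lam)
    (x₁ : Fin (M₂ + M₂) → v.adicCompletion (Fp L)) :
    (frameLin (Fp L) v ((M₂ + M₂) + (M₂ + M₂)) PD).symm
        ((glEquiv B).symm (frameLin (Fp L) v ((M₂ + M₂) + (M₂ + M₂)) PD (glue (blkIdx M₂ M₂) x₁ 0))) =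
      glue (blkIdx M₂ M₂)
        ((Sum.elim
            (fun l => QuadraticCoordinates.re
              (quadraticLocalEquiv L v (IsCMField.complexConj L) (complexConj_imagUnit L) (imagUnit_ne_zero L)).toLinearEquiv.toAddEquiv
              (G i₀ i₀ * (UnitaryGroup.toLocalRing L v (x₁ (e₂ M₂ (Sum.inl l))) +
                UnitaryGroup.toLocalRing L v (x₁ (e₂ M₂ (Sum.inr l))) * algebraMap L (LocalRing L v) (imagUnit L))))
            (fun l => QuadraticCoordinates.im
              (quadraticLocalEquiv L v (IsCMField.complexConj L) (complexConj_imagUnit L) (imagUnit_ne_zero L)).toLinearEquiv.toAddEquiv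
              (G i₀ i₀ * (UnitaryGroup.toLocalRing L v (x₁ (e₂ M₂ (Sum.inl l))) +
                UnitaryGroup.toLocalRing L v (x₁ (e₂ M₂ (Sum.inr l))) * algebraMap L (LocalRing L v) (imagUnit L))))) ∘ (e₂ M₂).symm)
        (lam • x₁) := by
  haveI : Algebra.IsQuadraticExtension (Fp L) L := IsCMField.isQuadraticExtension L
  refine frameLin_symm_glEquiv_symm_frameLin_glue_smul L e dV hdV dW hdW eW e' dV' hdV' v P hPσ hP hPD hTv₁ K₁ hK₁ Q₁ hQ₁ p₁ hp₁ hTv₂ K₂ hK₂ Q₂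
    hQ₂ p₂ hp₂ hi hσ₀ hσ₁ hTv p₀ hB0 G hG B hB lam hlam x₁ _ fun l => ?_
  simp only [Function.comp_apply, Equiv.symm_apply_apply, Sum.elim_inl, Sum.elim_inr]
  exact (UnitaryGroup.isQuadraticCoordinates_local L v (IsCMField.complexConj L) (complexConj_imagUnit L) (imagUnit_ne_zero L)
    (imagUnit_mul_self L)).re_add_im _

include hPσ hK₁ hQ₁ hp₁ hK₂ hQ₂ hp₂ hi hσ₀ hσ₁ hB0 hG hB in
/-- **THE POINT FORMULA, DOCKED ON ★ p864769's `hZm`** (the (an-3c) cone-chart letter, BY VALUE): for any multiplication graph `Zm` satisfying `hZm` at `d = d_v`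
along slot equivalences `eJ, eJ′` that enumerate the box coordinates as `(l, 0) ↦ e₂ (inl l)`, `(l, 1) ↦ e₂ (inr l)`, and `G i₁ i₀ = ι λ`:
`P̂D⁻¹ (B⁻¹ (P̂D (x₁ ⊔ 0))) = Z_{x₁} (re G₀₀, im G₀₀) ⊔ (λ • x₁)` — the graph point of ★ p864562 `coneWord_of_stageLetters`' slot (L2).
[cite: Kudla1994, §3 Thm. 3.1] [cite: HarrisKudlaSweet1996, §1 (1.11)–(1.12)] [cite: KudlaRallis1994, §2 (2.10)–(2.12)] -/
theorem frameLin_symm_glEquiv_symm_frameLin_glue_of_hZm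
    (Zm : (Fin (M₂ + M₂) → v.adicCompletion (Fp L)) → ((Fin 2 → v.adicCompletion (Fp L)) →ₗ[v.adicCompletion (Fp L)] (Fin (M₂ + M₂) → v.adicCompletion (Fp L))))
    (eJ eJ' : Fin M₂ × Fin 2 ≃ Fin (M₂ + M₂))
    (heJ₀ : ∀ l, eJ (l, 0) = e₂ M₂ (Sum.inl l)) (heJ₁ : ∀ l, eJ (l, 1) = e₂ M₂ (Sum.inr l))
    (heJ'₀ : ∀ l, eJ' (l, 0) = e₂ M₂ (Sum.inl l)) (heJ'₁ : ∀ l, eJ' (l, 1) = e₂ M₂ (Sum.inr l))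
    (hZm : ∀ (s : Fin (M₂ + M₂) → v.adicCompletion (Fp L)) (ζ : Fin 2 → v.adicCompletion (Fp L)) (j : Fin M₂),
      Zm s ζ (eJ (j, 0)) = ζ 0 * s (eJ' (j, 0)) + (imagUnitSq L : v.adicCompletion (Fp L)) * ζ 1 * s (eJ' (j, 1)) ∧
      Zm s ζ (eJ (j, 1)) = ζ 0 * s (eJ' (j, 1)) + ζ 1 * s (eJ' (j, 0)))
    (lam : v.adicCompletion (Fp L)) (hlam : G i₁ i₀ = UnitaryGroup.toLocalRing L v lam) (x₁ : Fin (M₂ + M₂) → v.adicCompletion (Fp L)) :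
    (frameLin (Fp L) v ((M₂ + M₂) + (M₂ + M₂)) PD).symm
        ((glEquiv B).symm (frameLin (Fp L) v ((M₂ + M₂) + (M₂ + M₂)) PD (glue (blkIdx M₂ M₂) x₁ 0))) =
      glue (blkIdx M₂ M₂)
        (Zm x₁ ![QuadraticCoordinates.re
            (quadraticLocalEquiv L v (IsCMField.complexConj L) (complexConj_imagUnit L) (imagUnit_ne_zero L)).toLinearEquiv.toAddEquiv (G i₀ i₀),
          QuadraticCoordinates.im
            (quadraticLocalEquiv L v (IsCMField.complexConj L) (complexConj_imagUnit L) (imagUnit_ne_zero L)).toLinearEquiv.toAddEquiv (G i₀ i₀)])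
        (lam • x₁) := by
  haveI : Algebra.IsQuadraticExtension (Fp L) L := IsCMField.isQuadraticExtension L
  have h := UnitaryGroup.isQuadraticCoordinates_local L v (IsCMField.complexConj L) (complexConj_imagUnit L) (imagUnit_ne_zero L) (imagUnit_mul_self L)
  refine frameLin_symm_glEquiv_symm_frameLin_glue_smul L e dV hdV dW hdW eW e' dV' hdV' v P hPσ hP hPD hTv₁ K₁ hK₁ Q₁ hQ₁ p₁ hp₁ hTv₂ K₂ hK₂ Q₂
    hQ₂ p₂ hp₂ hi hσ₀ hσ₁ hTv p₀ hB0 G hG B hB lam hlam x₁ _ fun l => ?_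
  obtain ⟨h0, h1⟩ := hZm x₁
    ![QuadraticCoordinates.re
        (quadraticLocalEquiv L v (IsCMField.complexConj L) (complexConj_imagUnit L) (imagUnit_ne_zero L)).toLinearEquiv.toAddEquiv (G i₀ i₀),
      QuadraticCoordinates.im
        (quadraticLocalEquiv L v (IsCMField.complexConj L) (complexConj_imagUnit L) (imagUnit_ne_zero L)).toLinearEquiv.toAddEquiv (G i₀ i₀)] l
  rw [heJ₀, heJ'₀, heJ'₁] at h0
  rw [heJ₁, heJ'₀, heJ'₁] at h1
  simp only [Matrix.cons_val_zero, Matrix.cons_val_one] at h0 h1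
  rw [h0, h1]
  conv_rhs => rw [← h.re_add_im (G i₀ i₀), h.mul_formula]
  simp only [mul_assoc]

end Normalised

end Tensor

end Summit.HodgeConjecture.HodgeConjecture.Cruxes.HLiu418.K2LiuConeGraphReadingPoint

end
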